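import Summits.BirchSwinnertonDyer.BirchSwinnertonDyer.Theses.PrintX10b
import Summits.BirchSwinnertonDyer.BirchSwinnertonDyer.Theorems.PrintX10bHowardContainmentAnyClassNumberX10bThm413Hyp
import Summits.BirchSwinnertonDyer.BirchSwinnertonDyer.Theorems.PrintX9HowardContainmentLightFrameOfPrintDepthPosLocalized
import Literature.NumberTheory.EllipticCurves.IwasawaAlgebraPromotionProofs
import HarnessLib

/-!
# Line `torsion-depth-x10b-pinned` — the X10b (p = 3) TWIN of PrintX9 rev 20's skeleton of record
# `torsion-depth-pinned` (x9-p1 LEAD re-cut, plan g9), for the PIN-1-repaired restatement of crux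
# stmt-BirchSwinnertonDyer-23729 `PrintX10b.HowardContainmentAnyClassNumberX10b` (PrintX10b rev 20, pending)

Seat `bsd-line-x10b-p2` LEAD g2, 2026-08-28. HONEST FRAMING: a SKELETON (sorries only through the two
`stub_*` below); the route decls of PrintX10b rev 20 do not exist yet, so §0 carries LOCAL copies of the
texts this seat RECOMMENDS the pen files (swapped for `Theses.PrintX10b.…` the minute the gate renders
them); nothing is closed; no summit statement is proved; BSD is not proved by any of this.

RECOMMENDED SHAPE = LIGHT (this file): the X10b twin of PrintX9 rev 20a `HowardContainmentLightFramePinned`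
LETTER FOR LETTER with `Rank1Residual.ClassX9 W p ↦ ClassX10 W p → ¬ Surj W 3 → ¬ W.HasCM` — i.e. A₃ on the
frames where it is CONSUMED (x10b-p1-w2's A₃♯, `Theorems/PrintX10bBeyondCarrierDepthOfSharpTwins.lean`:
odd `d_K ≠ -3`, (irr_K), Manin-good `Dt`, `rank E(K) = 1`, `Ш[3^∞]` finite), PINNED (`¬ (p : ℤ) ∣ Dt.c`,
tie `F.Dt = Dt`). Why LIGHT and not PIN-1 R3's broad text (A₃'s own binders + pin + tie): (a) every kernel
consumer of A₃ instantiates it at `d_K % 8 = 1`, rank one, `Ш[3^∞]` finite (23055's glue); (b) on the broad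
frames two regimes have NO typed print at `3 ∣ h_K` — even `d_K` (CGLS 2022 / CGS 2025 carry (disc); MZ26 /
Howard carry `p ∤ h_K`) and Selmer corank `≠ 1` (the `(γ-1)`-part: closable by typing CGS 2025 Thm. 6.5.2 at
any class number — proposed p610515 — but still an extra binder on the OfPrint crux); (c) LIGHT makes the
X10b line the X9 line verbatim: same two open stubs, dischargeable by the SAME p-generic engines (x9-p2's
envelope, x9-p1's μ-census), zero X10b-specific mathematics beyond the landed `X10.*` bookkeeping.

REGIMES / STUBS (3 registered-to-be, 2 open — exactly as on X9):
* `stub_coprimeTied`  — `3 ∤ h_K`: PROVED here from binder `hMZ` (Mastella–Zerman 2026 Cor. 4.6 BY NAME) via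
  the landed `X10.heegnerContainmentPinned_of_cor46_of_not_surj` (p607508). PRINT.
* `Stmt.localizedTied` — any class number, `3` inverted, stabilized datum TIED to `Dt`: PROVED
  (`localizedTied_of_print`) from `hCGLS` (CGLS 2022 Thm. 4.1.3 BY NAME, "Moreover" at corank one) + `hTw`
  (tower ⇒ `StabilizedHeegnerData.exists_of_tower`, p608385) + `X10.thm413Hypotheses_of_classX10` (p606553).
  PRINT modulo typing. (Kept as a theorem; the composition applies CGLS in `∀`-form at s_env's `C`.)
* `stub_envelopeTied` — OPEN: twin of x9's `Stmt.envelopeTied` (coherent `(C, F, e)` on the frame's `Dt`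
  with `(p^e)·I(ℋ_F) ⊆ I(Λκ_∞(C))` and `𝔖/ℋ_F` torsion) — to be discharged by x9-p2's p-generic engine.
* `stub_muPartTied`   — OPEN, BEYOND PRINT at `3 ∣ h_K`: the μ-part for the pinned family; reduced in the
  kernel to `μ(X_tors) = 0` by `muPartTied_of_muInvariant_eq_zero` (x10b-p1's p607965).
Composition `HowardContainmentAnyClassNumberX10bPinnedOfPrint_of` is sorry-free.
-/

set_option linter.dupNamespace false
set_option autoImplicit false

noncomputable section

open scoped Classical
open Literature Literature.NumberTheory.EllipticCurves WeierstrassCurve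
  Literature.NumberTheory.EllipticCurves.ModularForms
open Literature.NumberTheory.EllipticCurves.Rank1Residual (ClassX10 Surj)
open Summit.BirchSwinnertonDyer.BirchSwinnertonDyer.Theses.PrintX9
  (MastellaZermanHowardDivisibility CGLSHowardDivisibilityLocalized AnticyclotomicTowerInRingClassFields)

/-! ## §0 Local copies of the RECOMMENDED rev-20 route decls (swapped for the `Theses.PrintX10b` decls
once filed; the three supports are PrintX9's stmt-25233 / 25234 / 25236 bodies, to be dedup'ed onto
PrintX10b per gen-1's TURNKEY). -/
namespace Summit.BirchSwinnertonDyer.BirchSwinnertonDyer.Theses.PrintX10bRev20Local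

/-- **A₃^pin (LIGHT)** — X10b twin of PrintX9 rev 20a `HowardContainmentLightFramePinned`. -/
def HowardContainmentAnyClassNumberX10bPinned : Prop :=
  ∀ (W : WeierstrassCurve ℚ) [W.IsElliptic] [W.IsGloballyMinimal] (p : ℕ) [Fact p.Prime] [NeZero (W.conductorNorm ℤ)] (K : Type) [Field K] [NumberField K], Literature.NumberTheory.EllipticCurves.Rank1Residual.ClassX10 W p → ¬ Literature.NumberTheory.EllipticCurves.Rank1Residual.Surj W 3 → ¬ W.HasCM → Literature.NumberTheory.EllipticCurves.IsImaginaryQuadratic K → Odd (NumberField.discr K) → NumberField.discr K ≠ -3 → Literature.NumberTheory.EllipticCurves.SatisfiesHeegnerHypothesis (W.conductorNorm ℤ) K → Literature.NumberTheory.EllipticCurves.SatisfiesHeegnerHypothesis p K → (W.baseChange K).HasIrreducibleModPGaloisRep p → ∀ (κ : Literature.NumberTheory.EllipticCurves.ZpExtension K p), κ.IsAnticyclotomic → ∀ (γ : Field.absoluteGaloisGroup K), κ.IsTopGenerator γ → ∀ (Dt : Literature.NumberTheory.EllipticCurves.ModularForms.ModularParametrizationData W (W.conductorNorm ℤ)) (H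 : Literature.NumberTheory.EllipticCurves.HeegnerDatum (W.conductorNorm ℤ) (NumberField.discr K)) (ιC : K →+* ℂ), ¬ (p : ℤ) ∣ Dt.c → (W.baseChange K).mordellWeilRank = 1 → Finite (AddCommGroup.primaryComponent (W.baseChange K).sha p) → ∃ (jbar : AlgebraicClosure K →+* ℂ) (D : (W.baseChange K).LambdaAdicSelmerData κ γ) (F : Literature.NumberTheory.EllipticCurves.HeegnerFamily (W.conductorNorm ℤ) W K κ jbar) (X : (W.baseChange K).SelmerDualData κ γ), F.Dt = Dt ∧ Literature.NumberTheory.EllipticCurves.heegnerCharIdeal D F ^ 2 ≤ Literature.NumberTheory.EllipticCurves.Module.charIdeal (Literature.NumberTheory.EllipticCurves.IwasawaAlgebra p) (Submodule.torsion (Literature.NumberTheory.EllipticCurves.IwasawaAlgebra p) X.X)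

/-- **The DECIDING crux (recommended)**: A₃^pin from the three print supports BY NAME. -/
def HowardContainmentAnyClassNumberX10bPinnedOfPrint : Prop :=
  MastellaZermanHowardDivisibility → CGLSHowardDivisibilityLocalized → AnticyclotomicTowerInRingClassFields →
    HowardContainmentAnyClassNumberX10bPinned

end Summit.BirchSwinnertonDyer.BirchSwinnertonDyer.Theses.PrintX10bRev20Local

namespace Summit.BirchSwinnertonDyer.BirchSwinnertonDyer.Cruxes.HowardContainmentAnyClassNumberX10bPinnedOfPrint.TorsionDepthX10bPinned

/-! ## §1 Stub statements (the LIGHT X10b frame binders, verbatim, plus a GIVEN `jbar`) -/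

/-- s_cop: the `3 ∤ h_K` regime, tied (MZ26 Cor. 4.6 by name). -/
def Stmt.coprimeTied : Prop :=
  MastellaZermanHowardDivisibility →
    ∀ (W : WeierstrassCurve ℚ) [W.IsElliptic] [W.IsGloballyMinimal] (p : ℕ) [Fact p.Prime]
      [NeZero (W.conductorNorm ℤ)] (K : Type) [Field K] [NumberField K],
      ClassX10 W p → ¬ Surj W 3 → ¬ W.HasCM →
      IsImaginaryQuadratic K → Odd (NumberField.discr K) → NumberField.discr K ≠ -3 →
      SatisfiesHeegnerHypothesis (W.conductorNorm ℤ) K → SatisfiesHeegnerHypothesis p K →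
      (W.baseChange K).HasIrreducibleModPGaloisRep p →
      ∀ (κ : ZpExtension K p), κ.IsAnticyclotomic → ∀ (γ : Field.absoluteGaloisGroup K),
      κ.IsTopGenerator γ →
      ∀ (Dt : ModularParametrizationData W (W.conductorNorm ℤ))
        (H : HeegnerDatum (W.conductorNorm ℤ) (NumberField.discr K)) (ιC : K →+* ℂ)
        (jbar : AlgebraicClosure K →+* ℂ),
      ¬ (p : ℤ) ∣ Dt.c → (W.baseChange K).mordellWeilRank = 1 →
      Finite (AddCommGroup.primaryComponent (W.baseChange K).sha p) →
      ¬ p ∣ NumberField.classNumber K →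
      ∃ (D : (W.baseChange K).LambdaAdicSelmerData κ γ)
        (F : HeegnerFamily (W.conductorNorm ℤ) W K κ jbar) (X : (W.baseChange K).SelmerDualData κ γ),
        F.Dt = Dt ∧ heegnerCharIdeal D F ^ 2 ≤
          Module.charIdeal (IwasawaAlgebra p) (Submodule.torsion (IwasawaAlgebra p) X.X)

/-- s_loc: CGLS 4.1.3 localized at the frame ("Moreover", corank one), stabilized datum TIED to `Dt`
(any class number, any torsion depth). -/
def Stmt.localizedTied : Prop :=
  CGLSHowardDivisibilityLocalized → AnticyclotomicTowerInRingClassFields →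
    ∀ (W : WeierstrassCurve ℚ) [W.IsElliptic] [W.IsGloballyMinimal] (p : ℕ) [Fact p.Prime]
      [NeZero (W.conductorNorm ℤ)] (K : Type) [Field K] [NumberField K],
      ClassX10 W p → ¬ Surj W 3 → ¬ W.HasCM →
      IsImaginaryQuadratic K → Odd (NumberField.discr K) → NumberField.discr K ≠ -3 →
      SatisfiesHeegnerHypothesis (W.conductorNorm ℤ) K → SatisfiesHeegnerHypothesis p K →
      (W.baseChange K).HasIrreducibleModPGaloisRep p →
      ∀ (κ : ZpExtension K p), κ.IsAnticyclotomic → ∀ (γ : Field.absoluteGaloisGroup K),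
      κ.IsTopGenerator γ →
      ∀ (Dt : ModularParametrizationData W (W.conductorNorm ℤ))
        (H : HeegnerDatum (W.conductorNorm ℤ) (NumberField.discr K)) (ιC : K →+* ℂ)
        (jbar : AlgebraicClosure K →+* ℂ),
      ¬ (p : ℤ) ∣ Dt.c → (W.baseChange K).mordellWeilRank = 1 →
      Finite (AddCommGroup.primaryComponent (W.baseChange K).sha p) →
      ∃ (D : (W.baseChange K).LambdaAdicSelmerData κ γ)
        (C : CastellaGrossiLeeSkinner2022.StabilizedHeegnerData (W.conductorNorm ℤ) W K κ jbar)
        (X : (W.baseChange K).SelmerDualData κ γ) (m : ℕ),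
        C.Dt = Dt ∧ Ideal.span {((p : IwasawaAlgebra p) ^ m)} *
            CastellaGrossiLeeSkinner2022.stabilizedHeegnerCharIdeal D C ^ 2 ≤
          Module.charIdeal (IwasawaAlgebra p) (Submodule.torsion (IwasawaAlgebra p) X.X)

/-- s_env: the Heegner-module ENVELOPE on a light X10b frame, for the GIVEN `jbar` and EVERY `Λ`-adic Selmer
datum `D` — the stub OUTPUTS a CGLS datum `C` and a Heegner family `F`, BOTH on the frame's `Dt` (coherent:
same CM system), and `e : ℕ` with `(p^e)·I(ℋ_F) ⊆ I(Λκ_∞(C))` and `𝔖/ℋ_F` torsion. X10b twin of x9-p1's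
`Stmt.envelopeTied` letter for letter (`ClassX9 ↦ ClassX10 ∧ ¬Surj 3 ∧ ¬CM`); content p-generic
(generation `ℋ_F` vs `Λκ_∞(C)`: Howard 2004 §3.3 / Thm. 3.3.7 at `p ∤ h_K`, CGLS 2022 §4.1 `d(k)`-shift and
Rem. 4.1.4 at any class number, vertical distribution relations; non-torsion: CGLS Thm. 4.1.1 /
Cornut–Vatsal; `E(K_n)[p] = 0` along the tower from (irr_K): `PrintX9Rescaling.fixedGeomPoints_eq_zero_…`). -/
def Stmt.envelopeTied : Prop :=
  AnticyclotomicTowerInRingClassFields →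
    ∀ (W : WeierstrassCurve ℚ) [W.IsElliptic] [W.IsGloballyMinimal] (p : ℕ) [Fact p.Prime]
      [NeZero (W.conductorNorm ℤ)] (K : Type) [Field K] [NumberField K],
      ClassX10 W p → ¬ Surj W 3 → ¬ W.HasCM →
      IsImaginaryQuadratic K → Odd (NumberField.discr K) → NumberField.discr K ≠ -3 →
      SatisfiesHeegnerHypothesis (W.conductorNorm ℤ) K → SatisfiesHeegnerHypothesis p K →
      (W.baseChange K).HasIrreducibleModPGaloisRep p →
      ∀ (κ : ZpExtension K p), κ.IsAnticyclotomic → ∀ (γ : Field.absoluteGaloisGroup K),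
      κ.IsTopGenerator γ →
      ∀ (Dt : ModularParametrizationData W (W.conductorNorm ℤ))
        (H : HeegnerDatum (W.conductorNorm ℤ) (NumberField.discr K))
        (jbar : AlgebraicClosure K →+* ℂ) (D : (W.baseChange K).LambdaAdicSelmerData κ γ),
      ¬ (p : ℤ) ∣ Dt.c →
      ∃ (C : CastellaGrossiLeeSkinner2022.StabilizedHeegnerData (W.conductorNorm ℤ) W K κ jbar)
        (F : HeegnerFamily (W.conductorNorm ℤ) W K κ jbar) (e : ℕ),
        C.Dt = Dt ∧ F.Dt = Dt ∧
        Ideal.span {((p : IwasawaAlgebra p) ^ e)} * heegnerCharIdeal D F ≤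
          CastellaGrossiLeeSkinner2022.stabilizedHeegnerCharIdeal D C ∧
        Module.IsTorsion (IwasawaAlgebra p) (D.S ⧸ heegnerModule D F)

/-- s_mu: the μ-part at `3 ∣ h_K` — family-localized TIED ⟹ integral TIED (BEYOND PRINT); the hypothesis
carries `Module.Finite Λ X.X` (CGLS 4.1.3's rank clause, threaded by the composition). X10b twin of x9-p1's
`Stmt.muPartTied` letter for letter. -/
def Stmt.muPartTied : Prop :=
    ∀ (W : WeierstrassCurve ℚ) [W.IsElliptic] [W.IsGloballyMinimal] (p : ℕ) [Fact p.Prime]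
      [NeZero (W.conductorNorm ℤ)] (K : Type) [Field K] [NumberField K],
      ClassX10 W p → ¬ Surj W 3 → ¬ W.HasCM →
      IsImaginaryQuadratic K → Odd (NumberField.discr K) → NumberField.discr K ≠ -3 →
      SatisfiesHeegnerHypothesis (W.conductorNorm ℤ) K → SatisfiesHeegnerHypothesis p K →
      (W.baseChange K).HasIrreducibleModPGaloisRep p →
      ∀ (κ : ZpExtension K p), κ.IsAnticyclotomic → ∀ (γ : Field.absoluteGaloisGroup K),
      κ.IsTopGenerator γ →
      ∀ (Dt : ModularParametrizationData W (W.conductorNorm ℤ))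
        (H : HeegnerDatum (W.conductorNorm ℤ) (NumberField.discr K)) (ιC : K →+* ℂ)
        (jbar : AlgebraicClosure K →+* ℂ),
      ¬ (p : ℤ) ∣ Dt.c → (W.baseChange K).mordellWeilRank = 1 →
      Finite (AddCommGroup.primaryComponent (W.baseChange K).sha p) →
      p ∣ NumberField.classNumber K →
      (∃ (D : (W.baseChange K).LambdaAdicSelmerData κ γ)
          (F : HeegnerFamily (W.conductorNorm ℤ) W K κ jbar) (X : (W.baseChange K).SelmerDualData κ γ) (m : ℕ),
          F.Dt = Dt ∧ Module.Finite (IwasawaAlgebra p) X.X ∧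
          Ideal.span {((p : IwasawaAlgebra p) ^ m)} * heegnerCharIdeal D F ^ 2 ≤
            Module.charIdeal (IwasawaAlgebra p) (Submodule.torsion (IwasawaAlgebra p) X.X)) →
      ∃ (D : (W.baseChange K).LambdaAdicSelmerData κ γ)
        (F : HeegnerFamily (W.conductorNorm ℤ) W K κ jbar) (X : (W.baseChange K).SelmerDualData κ γ),
        F.Dt = Dt ∧ heegnerCharIdeal D F ^ 2 ≤
          Module.charIdeal (IwasawaAlgebra p) (Submodule.torsion (IwasawaAlgebra p) X.X)

/-! ## §2 Registered-to-be stubs -/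

/-- `d_K` odd excludes `d_K = -4`. [folklore] -/
theorem discr_ne_neg_four_of_odd {K : Type} [Field K] [NumberField K] (hodd : Odd (NumberField.discr K)) :
    NumberField.discr K ≠ -4 := by
  rintro h; rw [h] at hodd; exact absurd hodd (by decide)

/-- **stub s_cop (PROVED, print: Mastella–Zerman 2026 Cor 4.6 by name at `p = 3`, scalars `1 + 3ℤ₃`).**
The route binder `hMZ` is by body the Literature fact `cor46_howardDivisibility_of_scalarImage.{0}`; the
tied X10b discharge is the landed `X10.heegnerContainmentPinned_of_cor46_of_not_surj` (p607508).
[cite: MastellaZerman2026, Cor. 4.6 (arXiv:2505.08710)] [cite: LombardoTronto2022, Prop. 3.12] -/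
theorem stub_coprimeTied : Stmt.coprimeTied := by
  intro hMZ W _ _ p _ _ K _ _ hX hns hcm hK hodd h3 hHN hHp _ κ hκ γ hγ Dt H _ jbar _ _ _ hhK
  have h46 : MastellaZerman2026.cor46_howardDivisibility_of_scalarImage.{0} := hMZ
  obtain ⟨D, F, X, hFD, -, hle⟩ :=
    Summit.BirchSwinnertonDyer.BirchSwinnertonDyer.Rank1Residual.X10.heegnerContainmentPinned_of_cor46_of_not_surj
      h46 hX hns hcm hK h3 (discr_ne_neg_four_of_odd hodd) hHN hHp hhK κ hκ γ hγ Dt H jbar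
  exact ⟨D, F, X, hFD, hle⟩

/-- **s_loc (PROVED, print modulo typing: CGLS 2022 Thm 4.1.3 by name + the tower) — kept as a THEOREM;
the composition applies the CGLS fact in `∀`-form at the envelope's `C` instead.** The stabilized datum on
the frame's `Dt` comes from the tower (x9-p2's `X9.exists_stabilizedHeegnerData_of_tower`, p607064 = Literature `StabilizedHeegnerData.exists_of_tower`, p608385), the hypothesis
record from `X10.thm413Hypotheses_of_classX10` (p606553), corank one from rank one + `Ш[p^∞]` finite.
[cite: CastellaGrossiLeeSkinner2022, Thm. 4.1.3 ("Moreover") + Rem. 4.1.4 (arXiv:2008.02571v2 TeX L2253–2294)] -/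
theorem localizedTied_of_print : Stmt.localizedTied := by
  intro hCGLS hTw W _ _ p _ _ K _ _ hX hns hcm hK hodd h3 hHN hHp _ κ hκ γ hγ Dt H _ jbar _ hrk hfin
  have hp_odd : Odd p := (Fact.out : p.Prime).odd_of_ne_two hX.ne_two
  obtain ⟨D⟩ := LambdaAdicSelmerDataExists.nonempty_lambdaAdicSelmerData (W.baseChange K) p κ hγ
  obtain ⟨X⟩ := (W.baseChange K).nonempty_selmerDualData_holds κ γ hγ
  obtain ⟨C, hCDt, -, -⟩ := Summit.BirchSwinnertonDyer.Rank1Residual.X9.exists_stabilizedHeegnerData_of_tower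
    (κ := κ) (jbar := jbar) hK hHN hX.not_dvd_conductorNorm Dt H.dvd_sq_sub
    (fun k ↦ hTw K p hp_odd hK κ hκ jbar k)
  have h413 : CastellaGrossiLeeSkinner2022.thm413_rankOne_charIdeal_torsion_dvd_localized.{0} := hCGLS
  obtain ⟨m, hm⟩ := CastellaGrossiLeeSkinner2022.span_pow_mul_sq_le_charIdeal_torsion_of_thm413 h413
    (Summit.BirchSwinnertonDyer.BirchSwinnertonDyer.Rank1Residual.X10.thm413Hypotheses_of_classX10
      hX hK h3 hHN hHp hodd hκ hγ)
    (Summit.BirchSwinnertonDyer.Rank1Residual.X9.selmerCorank_eq_one_of_rank_one hrk hfin) D C X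
  exact ⟨D, C, X, m, hCDt, hm⟩

/-- **stub s_env (OPEN, M–L; print modulo typing at δ = 0, d(k)-shifted comparison at δ ≥ 1) — the twin of
PrintX9's `stub_envelopeTied`; to be discharged by x9-p2's p-generic envelope engine at `p = 3`.**
[cite: Howard2004HeegnerKolyvagin, §3.3 (Lemma 2.3.3, Thm. 3.3.7)] [cite: PerrinRiou1987BSMF, Prop. 10]
[cite: CastellaGrossiLeeSkinner2022, §4.1 (Thm. 4.1.1, Rem. 4.1.4)] -/
theorem stub_envelopeTied : Stmt.envelopeTied := by
  sorry

/-- **stub s_mu (OPEN, HARDEST, BEYOND PRINT): the μ-part of Howard's divisibility at `3 ∣ h_K` for the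
pinned family on X10b.** Reduction available: `muPartTied_of_muInvariant_eq_zero` below.
[cite: Howard2004HeegnerKolyvagin, Thm. B (μ needs p ∤ h_K)] [cite: MastellaZerman2026, Cor. 4.6 (p ∤ h_K)]
[cite: CastellaGrossiLeeSkinner2022, Cor. 3.4.2 (p inverted)] -/
theorem stub_muPartTied : Stmt.muPartTied := by
  sorry

/-- **s_mu REDUCES to `μ(X_tors) = 0` on X10b** (census-in-kernel, twin of x9-p1's reduction): if at every
rank-one light X10b frame with `3 ∣ h_K` the `Λ`-torsion of the Selmer dual has local length `0` at the
height-one prime `(3)`, then `Stmt.muPartTied` holds — x10b-p1's promotion lemma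
`IwasawaAlgebra.le_charIdeal_of_span_p_pow_mul_le` (p607965) applied to `A := I(ℋ_F)²`. The hypothesis is NOT
in print on class X10b at `3 ∣ h_K`. [cite: Washington1997, §13.2] [cite: MastellaZerman2026, Ass. 2.1, Cor. 4.6]
[cite: CastellaGrossiLeeSkinner2022, Cor. 3.4.2] -/
theorem muPartTied_of_muInvariant_eq_zero
    (hμ : ∀ (W : WeierstrassCurve ℚ) [W.IsElliptic] [W.IsGloballyMinimal] (p : ℕ) [Fact p.Prime]
      [NeZero (W.conductorNorm ℤ)] (K : Type) [Field K] [NumberField K],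
      ClassX10 W p → ¬ Surj W 3 → ¬ W.HasCM →
      IsImaginaryQuadratic K → Odd (NumberField.discr K) → NumberField.discr K ≠ -3 →
      SatisfiesHeegnerHypothesis (W.conductorNorm ℤ) K → SatisfiesHeegnerHypothesis p K →
      (W.baseChange K).HasIrreducibleModPGaloisRep p →
      ∀ (κ : ZpExtension K p), κ.IsAnticyclotomic → ∀ (γ : Field.absoluteGaloisGroup K),
      κ.IsTopGenerator γ →
      (W.baseChange K).mordellWeilRank = 1 →
      Finite (AddCommGroup.primaryComponent (W.baseChange K).sha p) →
      p ∣ NumberField.classNumber K →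
      ∀ (X : (W.baseChange K).SelmerDualData κ γ), Module.Finite (IwasawaAlgebra p) X.X →
      ∀ 𝔭 : PrimeSpectrum (IwasawaAlgebra p), 𝔭.asIdeal = Ideal.span {(p : IwasawaAlgebra p)} →
        Module.lengthAt (IwasawaAlgebra p) (Submodule.torsion (IwasawaAlgebra p) X.X) 𝔭 = 0) :
    Stmt.muPartTied := by
  intro W _ _ p _ _ K _ _ hX hns hcm hK hodd h3 hHN hHp hirr κ hκ γ hγ Dt H ιC jbar hc hrk hfin hhK
    ⟨D, F, X, m, hFDt, hfinX, hloc⟩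
  haveI := hfinX
  haveI : IsNoetherian (IwasawaAlgebra p) X.X := isNoetherian_of_isNoetherianRing_of_finite _ _
  haveI : Module.Finite (IwasawaAlgebra p) (Submodule.torsion (IwasawaAlgebra p) X.X) := inferInstance
  refine ⟨D, F, X, hFDt, ?_⟩
  exact IwasawaAlgebra.le_charIdeal_of_span_p_pow_mul_le
    (Submodule.torsion_isTorsion (R := IwasawaAlgebra p) (M := X.X))
    (hμ W p K hX hns hcm hK hodd h3 hHN hHp hirr κ hκ γ hγ hrk hfin hhK X hfinX) hloc

/-! ## §3 Composition (sorry-free) -/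

/-- Ideal bookkeeping: `(a) · ((b) · I)² = (a·b²) · I²`. [folklore] -/
theorem span_singleton_mul_sq {R : Type*} [CommSemiring R] (a b : R) (I : Ideal R) :
    Ideal.span {a} * (Ideal.span {b} * I) ^ 2 = Ideal.span {a * b ^ 2} * I ^ 2 := by
  rw [mul_pow, Ideal.span_singleton_pow, ← mul_assoc, Ideal.span_singleton_mul_span_singleton]

/-- **Composition**: fix the frame, `jbar := IsAlgClosed.lift` along `ιC`; `3 ∤ h_K` ↦ `s_cop hMZ`;
`3 ∣ h_K` ↦ `D`, `X` exist; `(C, F, e)` ← `s_env hTw`; CGLS Thm. 4.1.3 BY NAME in `∀`-form AT `(D, C, X)`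
(hypothesis record `X10.thm413Hypotheses_of_classX10`, corank one from rank one + `Ш[p^∞]` finite) ⇒
`(p^m)·I(Λκ_∞(C))² ⊆ char` ⇒ `(p^{m+2e})·I(ℋ_F)² ⊆ char` ⇒ `s_mu`. -/
theorem HowardContainmentAnyClassNumberX10bPinnedOfPrint_of
    (s_cop : Stmt.coprimeTied) (s_env : Stmt.envelopeTied) (s_mu : Stmt.muPartTied) :
    Summit.BirchSwinnertonDyer.BirchSwinnertonDyer.Theses.PrintX10bRev20Local.HowardContainmentAnyClassNumberX10bPinnedOfPrint := by
  intro hMZ hCGLS hTw W _ _ p _ _ K _ _ hX hns hcm hK hodd h3 hHN hHp hirr κ hκ γ hγ Dt H ιC hc hrk hfin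
  letI : Algebra K ℂ := ιC.toAlgebra
  let jbar : AlgebraicClosure K →+* ℂ :=
    (IsAlgClosed.lift (R := K) (M := ℂ) (S := AlgebraicClosure K)).toRingHom
  by_cases hhK : p ∣ NumberField.classNumber K
  · -- the data exist
    obtain ⟨D⟩ := LambdaAdicSelmerDataExists.nonempty_lambdaAdicSelmerData (W.baseChange K) p κ hγ
    obtain ⟨X⟩ := (W.baseChange K).nonempty_selmerDualData_holds κ γ hγ
    -- the envelope OUTPUTS the coherent pair `(C, F)` on `Dt`
    obtain ⟨C, F, e, -, hFDt, henv, -⟩ :=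
      s_env hTw W p K hX hns hcm hK hodd h3 hHN hHp hirr κ hκ γ hγ Dt H jbar D hc
    -- CGLS Thm. 4.1.3 BY NAME at `(D, C, X)`
    have h413 : CastellaGrossiLeeSkinner2022.thm413_rankOne_charIdeal_torsion_dvd_localized.{0} := hCGLS
    have hyp := Summit.BirchSwinnertonDyer.BirchSwinnertonDyer.Rank1Residual.X10.thm413Hypotheses_of_classX10
      hX hK h3 hHN hHp hodd hκ hγ
    obtain ⟨-, hfinX, -⟩ := h413 (W.conductorNorm ℤ) W K p κ γ jbar hyp D C X
    obtain ⟨m, hm⟩ := CastellaGrossiLeeSkinner2022.span_pow_mul_sq_le_charIdeal_torsion_of_thm413 h413 hyp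
      (Summit.BirchSwinnertonDyer.Rank1Residual.X9.selmerCorank_eq_one_of_rank_one hrk hfin) D C X
    -- `(p^{m+2e}) · I(ℋ_F)² ⊆ char(X_tors)`
    have hloc : Ideal.span {((p : IwasawaAlgebra p) ^ (m + e * 2))} * heegnerCharIdeal D F ^ 2 ≤
        Module.charIdeal (IwasawaAlgebra p) (Submodule.torsion (IwasawaAlgebra p) X.X) := by
      calc Ideal.span {((p : IwasawaAlgebra p) ^ (m + e * 2))} * heegnerCharIdeal D F ^ 2
          = Ideal.span {((p : IwasawaAlgebra p) ^ m)} *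
              (Ideal.span {((p : IwasawaAlgebra p) ^ e)} * heegnerCharIdeal D F) ^ 2 := by
            rw [span_singleton_mul_sq, ← pow_mul, ← pow_add]
        _ ≤ Ideal.span {((p : IwasawaAlgebra p) ^ m)} *
              CastellaGrossiLeeSkinner2022.stabilizedHeegnerCharIdeal D C ^ 2 :=
            Ideal.mul_mono_right (Ideal.pow_right_mono henv 2)
        _ ≤ _ := hm
    obtain ⟨D', F', X', hF', hle⟩ := s_mu W p K hX hns hcm hK hodd h3 hHN hHp hirr κ hκ γ hγ Dt H ιC
      jbar hc hrk hfin hhK ⟨D, F, X, m + e * 2, hFDt, hfinX, hloc⟩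
    exact ⟨jbar, D', F', X', hF', hle⟩
  · obtain ⟨D, F, X, hF, hle⟩ := s_cop hMZ W p K hX hns hcm hK hodd h3 hHN hHp hirr κ hκ γ hγ Dt H ιC
      jbar hc hrk hfin hhK
    exact ⟨jbar, D, F, X, hF, hle⟩

/-- the crux from the two OPEN stubs alone (s_cop discharged above; s_loc inlined as the CGLS call). -/
theorem HowardContainmentAnyClassNumberX10bPinnedOfPrint_of_open_stubs
    (s_env : Stmt.envelopeTied) (s_mu : Stmt.muPartTied) :
    Summit.BirchSwinnertonDyer.BirchSwinnertonDyer.Theses.PrintX10bRev20Local.HowardContainmentAnyClassNumberX10bPinnedOfPrint :=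
  HowardContainmentAnyClassNumberX10bPinnedOfPrint_of stub_coprimeTied s_env s_mu

/-- the composed line (sorries only through `stub_envelopeTied`, `stub_muPartTied`). -/
theorem HowardContainmentAnyClassNumberX10bPinnedOfPrint_of_stubs :
    Summit.BirchSwinnertonDyer.BirchSwinnertonDyer.Theses.PrintX10bRev20Local.HowardContainmentAnyClassNumberX10bPinnedOfPrint :=
  HowardContainmentAnyClassNumberX10bPinnedOfPrint_of stub_coprimeTied stub_envelopeTied stub_muPartTied

end Summit.BirchSwinnertonDyer.BirchSwinnertonDyer.Cruxes.HowardContainmentAnyClassNumberX10bPinnedOfPrint.TorsionDepthX10bPinned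

end
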